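import Summits.BirchSwinnertonDyer.BirchSwinnertonDyer.Theorems.ThetaPartnerAtTwoSignedKatoUpToAtTwoLayerPairingLiterature
import Literature.NumberTheory.EllipticCurves.Kato2004.IwasawaCohomologyUniqueProofs
import Literature.NumberTheory.EllipticCurves.Sprung2012.LocalIwasawaModule
import Literature.NumberTheory.GaloisRepresentations.EulerSystem
import HarnessLib

/-!
# Route `ByReductionTypeAtTwo` (rung K4), crux `SupersingularRankZeroAtTwo` (item stmt-BirchSwinnertonDyer-19097), line
# `odd_blind_package` v2.16, stub 3/6 `stub_flatPackage`, conjunct (8) — **THE LOCALISATION `loc_v : 𝐇¹_Γ(T_pW) → H¹_Iw(T_pW)` IN THE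
# TREE'S POINTS MODEL, AS A `Λ`-LINEAR MAP**: `pairFun : I.H →ₗ[Λ] (E(ℚ_∞·ℚ_v) →+ ℤ_p)`, `x ↦ (Q ↦ ⟨proj_n x, Q⟩_n)` (cell `bsd-2adic`,
# seat `bsd-2adic-tower-1` GEN 67, hand H2-F1F3 — the `loc` of the displayed-witness contract; `--supports 19097`, helper)

HONEST FRAMING (D-0054): THEOREMS ONLY — no definition, no named fact, no instance, no `sorry`.  Generic: any prime `p`, any
`ℤ_p`-extension `κ` of `ℚ` with a topological generator `γ` (`κ γ = 1`), any finite place `v`, any local `g` with `κ(res g) = 1`, any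
pin `I : Kato2004.IwasawaH1Data W p κ γ`, ANY family of `ℤ_p`-linear layer pairings `pair n : H¹(Γ_n, T_pW) → Hom(E(ℚ_{n,v}), ℤ_p)` with
the projection formula (P1) and the Galois invariance (P2) (e.g. THE `T_pW`-adic local Tate pairings of the layers,
`SignedKatoOffTwo.LayerPairing.exists_linear_tatePairing`, residues `CyclotomicLayer.tatePairingPk`).

## What and why

In the tree's transcription of the supersingular local theory (`Sprung2012/ColemanMaps.lean`, `LocalIwasawaModule.lean`) the local
Iwasawa cohomology `H¹_Iw(ℚ_v, T_pW)` IS the group of functionals `z : E(ℚ_∞·ℚ_v) →+ ℤ_p` (`localTowerPointsOfEmb κ ι W →+ ℤ_[p]`, `ι` the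
embedding of the place) with the `Λ`-structure `Sprung2012.moduleOfGenerator κ ι W hg` (`(T•z)(y) = z(g⁻¹y) − z(y)`), on which the Coleman
maps `Col^{♯/♭}` are `Λ`-linear (`isColemanPair_lambdaSMul`).  The Poitou–Tate skeleton of conjunct (8) (`𝐇¹_Γ →loc P ⊆ Λ →toX X♭ →δ X₀`)
and the explicit reciprocity law F3 (`Col♭(loc z_Kato) ∼ ϖ·L♭`) both need the LOCALISATION of a global Iwasawa class `x ∈ 𝐇¹_Γ(T_pW) = I.H`
AS SUCH A FUNCTIONAL: `Q ↦ ⟨proj_n x, Q⟩_n` for `Q` of level `n`, the `T_pW`-adic local Tate pairing of the layer component with the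
point.  This file proves it is well defined (independent of the level: (P1) + `I.cores_proj`), additive, and `Λ`-LINEAR for
`moduleOfGenerator` (the `Λ`-action on `𝐇¹` is levelwise `proj_n(f•x) = r(conj_γ − 1) proj_n x` for `r ≡ f (mod ω_n)`,
`IwasawaH1Data.proj_smul`; on functionals `(f•z)(y) = (r(Θ_g − 1)z)(y)`, `lambdaSMul_apply_eq_aeval`; the two agree by (P2) and
`conj_γ = conj_{res g}` on `H¹(Γ_n, ·)` — `κ(res g) = κ γ` EXACTLY (`IsTopGenerator`), so `(res g)⁻¹γ ∈ ker κ ≤ Γ_n` acts trivially,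
`conjMap_apply_one_eq_of_inv_mul_mem`).  So `loc := col♭ ∘ₗ pairFun` (with the Λ-linear joint Coleman map of
`SSFlatEC.exists_linearMap_isColemanPair_of_traces`) is the `loc` of the contract, `P := ⊤`.  Closes NO stub; 19097 OPEN; nothing booked;
BSD is proved for no curve; typed ≠ proved.

## What is proved
* `pair_proj_eq_of_le` — level independence `⟨proj_m x, Q⟩_m = ⟨proj_n x, Q⟩_n` (`Q` of level `m ≤ n`).
* `aeval_twistEnd_apply_eq_pair_aeval_conjMap` — for a functional `w` agreeing with `⟨c, ·⟩_n` on the layer `n`: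
  `(r(Θ_g − 1) w)(Q) = ⟨r(conj_{res g} − 1) c, Q⟩_n` (every `r ∈ ℤ_p[X]`).
* `conjMap_resGalOfEmb_eq_conjMap` — `conj_{res g} = conj_γ` on `H¹(Γ_n, T_pW)`.
* ★ `exists_linearMap_pairFun` — the `Λ`-linear `pairFun : I.H →ₗ[Λ] (E(ℚ_∞·ℚ_v) →+ ℤ_p)` with `pairFun x Q = ⟨proj_n x, Q⟩_n`.
* ★ `exists_linearMap_pairFun_tatePairing` — the same for THE `T_pW`-adic layer Tate pairings (cyclotomic `κ`, `v ∣ p`), with the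
  residue clause `toZModPow k (pairFun x Q) = tatePairingPk n k (proj_n x) Q` displayed.

References: [Kobayashi2003] (8.23) (p. 18); [PerrinRiou1994Invent] §3.6.1; [Kato2004Asterisque] §12.2 (p. 220), §13.8 (pp. 228–229), §17.13;
[Sprung2012] §2 p. 1486, Def. 3.1, Def. 5.9, Lemma 7.10; [SerreLocalFields1979] VII §5 Prop. 3; [NeukirchSchmidtWingberg2008] (1.6.3).
-/

set_option autoImplicit false
-- the Theorems namespace of this sub repeats the summit name by design (D-0017 nested layout)
set_option linter.dupNamespace false

noncomputable section

open scoped Classical NumberField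

open Polynomial

namespace Summit.BirchSwinnertonDyer.BirchSwinnertonDyer.Theorems

namespace SSFlatPackage

open Field NumberField IsDedekindDomain WeierstrassCurve
  Literature.NumberTheory.GaloisRepresentations
  Literature.NumberTheory.EllipticCurves Literature.NumberTheory.EllipticCurves.Kobayashi2003
  Literature.NumberTheory.EllipticCurves.Sprung2012 Literature.NumberTheory.EllipticCurves.Sprung2017
  Literature.NumberTheory.EllipticCurves.Kato2004 Literature.NumberTheory.EllipticCurves.Kato2004.EulerSystemValues ZpExtension

section Generic

variable (W : WeierstrassCurve ℚ) [W.IsElliptic] {p : ℕ} [Fact p.Prime] [ContinuousSMul ℤ_[p] (W.tateModule p)]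
  (κ : ZpExtension ℚ p) {γ : absoluteGaloisGroup ℚ} (v : HeightOneSpectrum (𝓞 ℚ))
  {g : absoluteGaloisGroup (v.adicCompletion ℚ)}
  (pair : ∀ n : ℕ, H1 (tateRep W p) (κ.layerSubgroup n) →ₗ[ℤ_[p]]
    (localLayerPointsOfEmb κ (closureEmb (K := ℚ) (v.adicCompletion ℚ)) W n →+ ℤ_[p]))

/-- **Level independence of `⟨proj_n x, Q⟩_n`.**  For a pin `I` and layer pairings with the projection formula (P1)
(`⟨Cor y, Q⟩_n = ⟨y, Q⟩_{n+1}` for `Q` of level `n`), a point `Q` of level `m ≤ n` pairs with `proj_m x` at level `m` as with `proj_n x` at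
level `n` (`I.cores_proj`). [cite: Kato2004Asterisque, §12.2 (p. 220)] [cite: Kobayashi2003, (8.23) (p. 18)] -/
theorem pair_proj_eq_of_le
    (hP1 : ∀ (n : ℕ) (x : H1 (tateRep W p) (κ.layerSubgroup (n + 1))) (Q : localPoints W (v.adicCompletion ℚ))
        (hQ : Q ∈ localLayerPointsOfEmb κ (closureEmb (K := ℚ) (v.adicCompletion ℚ)) W n),
        pair n (layerCores (tateRep W p) κ n x) ⟨Q, hQ⟩ =
          pair (n + 1) x ⟨Q, localLayerPointsOfEmb_mono κ (closureEmb (K := ℚ) (v.adicCompletion ℚ)) W (Nat.le_succ n) hQ⟩)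
    (I : IwasawaH1Data W p κ γ) (x : I.H) {m n : ℕ} (hmn : m ≤ n) (Q : localPoints W (v.adicCompletion ℚ))
    (hQ : Q ∈ localLayerPointsOfEmb κ (closureEmb (K := ℚ) (v.adicCompletion ℚ)) W m) :
    pair m (I.proj m x) ⟨Q, hQ⟩ =
      pair n (I.proj n x) ⟨Q, localLayerPointsOfEmb_mono κ (closureEmb (K := ℚ) (v.adicCompletion ℚ)) W hmn hQ⟩ := by
  induction n, hmn using Nat.le_induction with
  | base => rfl
  | succ n hmn ih =>
    rw [ih, ← I.cores_proj n x,
      hP1 n (I.proj (n + 1) x) Q (localLayerPointsOfEmb_mono κ (closureEmb (K := ℚ) (v.adicCompletion ℚ)) W hmn hQ)]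

/-- **Polynomials in `Θ_g − 1` versus polynomials in `conj_{res g} − 1`.**  If a functional `w` on `E(ℚ_∞·ℚ_v)` agrees on the layer
`n` with `⟨c, ·⟩_n` (`c ∈ H¹(Γ_n, T_pW)`) for layer pairings with the Galois invariance (P2) (`⟨conj_{res g} y, g•Q⟩ = ⟨y, Q⟩`), then for
every `r ∈ ℤ_p[X]` and `Q` of level `n`: `(r(Θ_g − 1) w)(Q) = ⟨r(conj_{res g} − 1) c, Q⟩_n` (`Θ_g w = w ∘ g⁻¹`).  Induction on `r`.
[cite: Sprung2012, §2 p. 1486 and Def. 3.1 (p. 1489)] [cite: SerreLocalFields1979, VII §5] -/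
theorem aeval_twistEnd_apply_eq_pair_aeval_conjMap
    (hP2 : ∀ (n : ℕ) (g : absoluteGaloisGroup (v.adicCompletion ℚ)) (y : H1 (tateRep W p) (κ.layerSubgroup n))
        (Q : localPoints W (v.adicCompletion ℚ))
        (hQ : Q ∈ localLayerPointsOfEmb κ (closureEmb (K := ℚ) (v.adicCompletion ℚ)) W n),
        pair n (conjMap (tateRep W p).toTopRep (κ.layerSubgroup n)
            (resGalOfEmb (closureEmb (K := ℚ) (v.adicCompletion ℚ)) g) 1 y)
          ⟨g • Q, smul_mem_localLayerPointsOfEmb κ (closureEmb (K := ℚ) (v.adicCompletion ℚ)) W n g hQ⟩ =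
        pair n y ⟨Q, hQ⟩)
    (n : ℕ) (r : ℤ_[p][X]) :
    ∀ (w : localTowerPointsOfEmb κ (closureEmb (K := ℚ) (v.adicCompletion ℚ)) W →+ ℤ_[p])
      (c : H1 (tateRep W p) (κ.layerSubgroup n)),
      (∀ (Q : localPoints W (v.adicCompletion ℚ))
          (hQ : Q ∈ localLayerPointsOfEmb κ (closureEmb (K := ℚ) (v.adicCompletion ℚ)) W n),
          w ⟨Q, localLayerPointsOfEmb_le_localTowerPointsOfEmb κ _ W n hQ⟩ = pair n c ⟨Q, hQ⟩) →
      ∀ (Q : localPoints W (v.adicCompletion ℚ))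
        (hQ : Q ∈ localLayerPointsOfEmb κ (closureEmb (K := ℚ) (v.adicCompletion ℚ)) W n),
        (aeval (twistEnd κ (closureEmb (K := ℚ) (v.adicCompletion ℚ)) W g - 1) r w)
            ⟨Q, localLayerPointsOfEmb_le_localTowerPointsOfEmb κ _ W n hQ⟩ =
          pair n (aeval ((conjMap (tateRep W p).toTopRep (κ.layerSubgroup n)
              (resGalOfEmb (closureEmb (K := ℚ) (v.adicCompletion ℚ)) g) 1).hom.toLinearMap - 1) r c) ⟨Q, hQ⟩ := by
  induction r using Polynomial.induction_on with
  | C a =>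
    intro w c hw Q hQ
    rw [aeval_C, aeval_C, Module.algebraMap_end_apply, Module.algebraMap_end_apply, map_smul,
      AddMonoidHom.smul_apply, AddMonoidHom.smul_apply, hw Q hQ]
  | add r₁ r₂ h₁ h₂ =>
    intro w c hw Q hQ
    simp only [map_add, LinearMap.add_apply, AddMonoidHom.add_apply]
    rw [h₁ w c hw Q hQ, h₂ w c hw Q hQ]
  | monomial k a hk =>
    intro w c hw Q hQ
    have eL : aeval (twistEnd κ (closureEmb (K := ℚ) (v.adicCompletion ℚ)) W g - 1) (Polynomial.C a * X ^ (k + 1)) =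
        aeval (twistEnd κ (closureEmb (K := ℚ) (v.adicCompletion ℚ)) W g - 1) (Polynomial.C a * X ^ k) *
          (twistEnd κ (closureEmb (K := ℚ) (v.adicCompletion ℚ)) W g - 1) := by
      rw [pow_succ, ← mul_assoc, map_mul, aeval_X]
    have eR : aeval ((conjMap (tateRep W p).toTopRep (κ.layerSubgroup n)
          (resGalOfEmb (closureEmb (K := ℚ) (v.adicCompletion ℚ)) g) 1).hom.toLinearMap - 1) (Polynomial.C a * X ^ (k + 1)) =
        aeval ((conjMap (tateRep W p).toTopRep (κ.layerSubgroup n)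
          (resGalOfEmb (closureEmb (K := ℚ) (v.adicCompletion ℚ)) g) 1).hom.toLinearMap - 1) (Polynomial.C a * X ^ k) *
          ((conjMap (tateRep W p).toTopRep (κ.layerSubgroup n)
            (resGalOfEmb (closureEmb (K := ℚ) (v.adicCompletion ℚ)) g) 1).hom.toLinearMap - 1) := by
      rw [pow_succ, ← mul_assoc, map_mul, aeval_X]
    rw [eL, eR, Module.End.mul_apply, Module.End.mul_apply]
    refine hk ((twistEnd κ (closureEmb (K := ℚ) (v.adicCompletion ℚ)) W g - 1) w) _ ?_ Q hQ
    intro Q' hQ'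
    have hgQ' : g⁻¹ • Q' ∈ localLayerPointsOfEmb κ (closureEmb (K := ℚ) (v.adicCompletion ℚ)) W n :=
      smul_mem_localLayerPointsOfEmb κ (closureEmb (K := ℚ) (v.adicCompletion ℚ)) W n g⁻¹ hQ'
    have h1 : w ⟨g⁻¹ • Q', smul_mem_localTowerPointsOfEmb κ (closureEmb (K := ℚ) (v.adicCompletion ℚ)) W g⁻¹
        (localLayerPointsOfEmb_le_localTowerPointsOfEmb κ _ W n hQ')⟩ = pair n c ⟨g⁻¹ • Q', hgQ'⟩ :=
      hw (g⁻¹ • Q') hgQ'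
    have h2 : pair n ((conjMap (tateRep W p).toTopRep (κ.layerSubgroup n)
        (resGalOfEmb (closureEmb (K := ℚ) (v.adicCompletion ℚ)) g) 1).hom.toLinearMap c) ⟨Q', hQ'⟩ =
        pair n c ⟨g⁻¹ • Q', hgQ'⟩ := by
      have h := hP2 n g c (g⁻¹ • Q') hgQ'
      have hQQ : (⟨g • g⁻¹ • Q', smul_mem_localLayerPointsOfEmb κ (closureEmb (K := ℚ) (v.adicCompletion ℚ)) W n g hgQ'⟩ :
          localLayerPointsOfEmb κ (closureEmb (K := ℚ) (v.adicCompletion ℚ)) W n) = ⟨Q', hQ'⟩ :=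
        Subtype.ext (smul_inv_smul g Q')
      rw [hQQ] at h
      exact h
    rw [LinearMap.sub_apply, Module.End.one_apply, AddMonoidHom.sub_apply, twistEnd_apply, LinearMap.sub_apply,
      Module.End.one_apply, map_sub, AddMonoidHom.sub_apply, h2]
    exact congrArg₂ (· - ·) h1 (hw Q' hQ')

/-- **`conj_{res g} = conj_γ` on `H¹(Γ_n, T_pW)`** for a topological generator `γ` (`κ γ = 1`) and a local `g` with `κ(res g) = 1`:
`(res g)⁻¹·γ ∈ ker κ ≤ Γ_n` and inner automorphisms act trivially. [cite: SerreLocalFields1979, VII §5 Prop. 3]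
[cite: NeukirchSchmidtWingberg2008, (1.6.3)] -/
theorem conjMap_resGalOfEmb_eq_conjMap (hγ : κ.IsTopGenerator γ)
    (hg : κ.IsTopGenerator (resGalOfEmb (closureEmb (K := ℚ) (v.adicCompletion ℚ)) g)) (n : ℕ)
    (c : H1 (tateRep W p) (κ.layerSubgroup n)) :
    conjMap (tateRep W p).toTopRep (κ.layerSubgroup n) (resGalOfEmb (closureEmb (K := ℚ) (v.adicCompletion ℚ)) g) 1 c =
      conjMap (tateRep W p).toTopRep (κ.layerSubgroup n) γ 1 c := by
  refine (conjMap_apply_one_eq_of_inv_mul_mem (tateRep W p).toTopRep (κ.layerSubgroup n) ?_ c).symm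
  refine κ.kerSubgroup_le_layerSubgroup n ?_
  have hγ' : κ γ = Multiplicative.ofAdd 1 := hγ
  have hg' : κ (resGalOfEmb (closureEmb (K := ℚ) (v.adicCompletion ℚ)) g) = Multiplicative.ofAdd 1 := hg
  rw [mem_kerSubgroup, map_mul, map_inv, hγ', hg', inv_mul_cancel]

/-- ★ **The localisation `pairFun : 𝐇¹_Γ(T_pW) → H¹_Iw(ℚ_v, T_pW)` in the points model, `Λ`-linear.**  For a topological generator `γ`,
a local `g` with `κ(res g) = 1`, ANY `ℤ_p`-linear layer pairings `pair n` with (P1) and (P2), and any pin `I`: there is a `Λ`-LINEAR map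
`L : I.H →ₗ[Λ] (E(ℚ_∞·ℚ_v) →+ ℤ_p)` (target `Λ`-structure `Sprung2012.moduleOfGenerator κ ι W hg`) with `L x Q = ⟨proj_n x, Q⟩_n` for
every `Q` of every level `n` — well defined by `pair_proj_eq_of_le`, `Λ`-linear by `IwasawaH1Data.proj_smul`, `lambdaSMul_apply_eq_aeval`,
`aeval_twistEnd_apply_eq_pair_aeval_conjMap` and `conjMap_resGalOfEmb_eq_conjMap`.  (No definition is introduced; by the displayed values
`L` is unique.) [cite: Kato2004Asterisque, §12.2 (p. 220) and §17.13 (p. 279)] [cite: Kobayashi2003, (8.23) (p. 18)]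
[cite: PerrinRiou1994Invent, §3.6.1] [cite: Sprung2012, §2 p. 1486, Def. 5.9] -/
theorem exists_linearMap_pairFun (hγ : κ.IsTopGenerator γ)
    (hg : κ.IsTopGenerator (resGalOfEmb (closureEmb (K := ℚ) (v.adicCompletion ℚ)) g))
    (hP1 : ∀ (n : ℕ) (x : H1 (tateRep W p) (κ.layerSubgroup (n + 1))) (Q : localPoints W (v.adicCompletion ℚ))
        (hQ : Q ∈ localLayerPointsOfEmb κ (closureEmb (K := ℚ) (v.adicCompletion ℚ)) W n),
        pair n (layerCores (tateRep W p) κ n x) ⟨Q, hQ⟩ =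
          pair (n + 1) x ⟨Q, localLayerPointsOfEmb_mono κ (closureEmb (K := ℚ) (v.adicCompletion ℚ)) W (Nat.le_succ n) hQ⟩)
    (hP2 : ∀ (n : ℕ) (g : absoluteGaloisGroup (v.adicCompletion ℚ)) (y : H1 (tateRep W p) (κ.layerSubgroup n))
        (Q : localPoints W (v.adicCompletion ℚ))
        (hQ : Q ∈ localLayerPointsOfEmb κ (closureEmb (K := ℚ) (v.adicCompletion ℚ)) W n),
        pair n (conjMap (tateRep W p).toTopRep (κ.layerSubgroup n)
            (resGalOfEmb (closureEmb (K := ℚ) (v.adicCompletion ℚ)) g) 1 y)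
          ⟨g • Q, smul_mem_localLayerPointsOfEmb κ (closureEmb (K := ℚ) (v.adicCompletion ℚ)) W n g hQ⟩ =
        pair n y ⟨Q, hQ⟩)
    (I : IwasawaH1Data W p κ γ) :
    letI := moduleOfGenerator κ (closureEmb (K := ℚ) (v.adicCompletion ℚ)) W hg
    ∃ L : I.H →ₗ[IwasawaAlgebra p] (localTowerPointsOfEmb κ (closureEmb (K := ℚ) (v.adicCompletion ℚ)) W →+ ℤ_[p]),
      ∀ (x : I.H) (n : ℕ) (Q : localPoints W (v.adicCompletion ℚ))
        (hQ : Q ∈ localLayerPointsOfEmb κ (closureEmb (K := ℚ) (v.adicCompletion ℚ)) W n),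
        L x ⟨Q, localLayerPointsOfEmb_le_localTowerPointsOfEmb κ _ W n hQ⟩ = pair n (I.proj n x) ⟨Q, hQ⟩ := by
  letI := moduleOfGenerator κ (closureEmb (K := ℚ) (v.adicCompletion ℚ)) W hg
  -- the value function and its characterisation on every layer
  let F : I.H → localTowerPointsOfEmb κ (closureEmb (K := ℚ) (v.adicCompletion ℚ)) W → ℤ_[p] := fun x y ↦
    pair (level κ (closureEmb (K := ℚ) (v.adicCompletion ℚ)) W y) (I.proj (level κ (closureEmb (K := ℚ) (v.adicCompletion ℚ)) W y) x) ⟨(y : localPoints W (v.adicCompletion ℚ)), mem_layer_level κ (closureEmb (K := ℚ) (v.adicCompletion ℚ)) W y⟩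
  have hF : ∀ (x : I.H) (n : ℕ) (Q : localPoints W (v.adicCompletion ℚ)) (hQ : Q ∈ localLayerPointsOfEmb κ (closureEmb (K := ℚ) (v.adicCompletion ℚ)) W n),
      F x ⟨Q, localLayerPointsOfEmb_le_localTowerPointsOfEmb κ (closureEmb (K := ℚ) (v.adicCompletion ℚ)) W n hQ⟩ = pair n (I.proj n x) ⟨Q, hQ⟩ := by
    intro x n Q hQ
    set y : localTowerPointsOfEmb κ (closureEmb (K := ℚ) (v.adicCompletion ℚ)) W := ⟨Q, localLayerPointsOfEmb_le_localTowerPointsOfEmb κ (closureEmb (K := ℚ) (v.adicCompletion ℚ)) W n hQ⟩ with hy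
    have h1 := pair_proj_eq_of_le W κ v pair hP1 I x (le_max_left (level κ (closureEmb (K := ℚ) (v.adicCompletion ℚ)) W y) n) Q (mem_layer_level κ (closureEmb (K := ℚ) (v.adicCompletion ℚ)) W y)
    have h2 := pair_proj_eq_of_le W κ v pair hP1 I x (le_max_right (level κ (closureEmb (K := ℚ) (v.adicCompletion ℚ)) W y) n) Q hQ
    exact h1.trans h2.symm
  -- additive in the point
  let L₀ : I.H → (localTowerPointsOfEmb κ (closureEmb (K := ℚ) (v.adicCompletion ℚ)) W →+ ℤ_[p]) := fun x ↦
    { toFun := F x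
      map_zero' := by
        have h0 : F x ⟨0, localLayerPointsOfEmb_le_localTowerPointsOfEmb κ (closureEmb (K := ℚ) (v.adicCompletion ℚ)) W 0 (zero_mem _)⟩ =
            pair 0 (I.proj 0 x) ⟨0, zero_mem _⟩ := hF x 0 0 (zero_mem _)
        have h00 : (⟨0, zero_mem _⟩ : localLayerPointsOfEmb κ (closureEmb (K := ℚ) (v.adicCompletion ℚ)) W 0) = 0 := rfl
        rw [h00, map_zero] at h0
        exact h0
      map_add' := by
        intro y₁ y₂
        obtain ⟨N, h₁, h₂⟩ := exists_mem_localLayerPointsOfEmb_pair κ (closureEmb (K := ℚ) (v.adicCompletion ℚ)) W y₁.2 y₂.2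
        have e₁ : F x y₁ = pair N (I.proj N x) ⟨y₁, h₁⟩ := hF x N y₁ h₁
        have e₂ : F x y₂ = pair N (I.proj N x) ⟨y₂, h₂⟩ := hF x N y₂ h₂
        have e₁₂ : F x (y₁ + y₂) = pair N (I.proj N x) ⟨(y₁ : localPoints W (v.adicCompletion ℚ)) + y₂, add_mem h₁ h₂⟩ :=
          hF x N _ (add_mem h₁ h₂)
        rw [e₁, e₂, e₁₂, ← map_add]
        rfl }
  have hL₀ : ∀ (x : I.H) (n : ℕ) (Q : localPoints W (v.adicCompletion ℚ)) (hQ : Q ∈ localLayerPointsOfEmb κ (closureEmb (K := ℚ) (v.adicCompletion ℚ)) W n),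
      L₀ x ⟨Q, localLayerPointsOfEmb_le_localTowerPointsOfEmb κ (closureEmb (K := ℚ) (v.adicCompletion ℚ)) W n hQ⟩ = pair n (I.proj n x) ⟨Q, hQ⟩ := hF
  refine ⟨{ toFun := L₀, map_add' := ?_, map_smul' := ?_ }, fun x n Q hQ ↦ hL₀ x n Q hQ⟩
  · -- additive in the class
    intro x x'
    ext y
    obtain ⟨n, hn⟩ := exists_mem_localLayerPointsOfEmb_of_mem_localTowerPointsOfEmb κ (closureEmb (K := ℚ) (v.adicCompletion ℚ)) W y.2
    have e : L₀ (x + x') y = pair n (I.proj n (x + x')) ⟨y, hn⟩ := hL₀ (x + x') n y hn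
    have e₁ : L₀ x y = pair n (I.proj n x) ⟨y, hn⟩ := hL₀ x n y hn
    have e₂ : L₀ x' y = pair n (I.proj n x') ⟨y, hn⟩ := hL₀ x' n y hn
    rw [AddMonoidHom.add_apply, e, e₁, e₂, map_add, map_add, AddMonoidHom.add_apply]
  · -- `Λ`-linear: both actions are levelwise through a polynomial representative modulo `ω_n`
    intro f x
    ext y
    obtain ⟨n, hn⟩ := exists_mem_localLayerPointsOfEmb_of_mem_localTowerPointsOfEmb κ (closureEmb (K := ℚ) (v.adicCompletion ℚ)) W y.2
    have hr := toIwasawa_dvd_sub_polyRep n f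
    set r : ℤ_[p][X] := polyRep p n f with hr_def
    have hfr : f - (r : PowerSeries ℤ_[p]) ∈
        Ideal.span {(((X + 1 : ℤ_[p][X]) ^ p ^ n - 1 : ℤ_[p][X]) : PowerSeries ℤ_[p])} := by
      rw [Ideal.mem_span_singleton, ← toIwasawa_cyclotomicOmega_eq_coe]
      exact hr
    have e : L₀ (f • x) y = pair n (I.proj n (f • x)) ⟨y, hn⟩ := hL₀ (f • x) n y hn
    rw [RingHom.id_apply, e, I.proj_smul hγ n hfr x, moduleOfGenerator_smul_eq, lambdaSMul_apply_eq_aeval hg f (L₀ x) hr hn,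
      aeval_twistEnd_apply_eq_pair_aeval_conjMap W κ v pair hP2 n r (L₀ x) (I.proj n x) (hL₀ x n) y hn]
    congr 2
    refine congrArg (fun T ↦ aeval (T - (1 : Module.End ℤ_[p] (H1 (tateRep W p) (κ.layerSubgroup n)))) r (I.proj n x)) ?_
    exact LinearMap.ext fun c ↦ (conjMap_resGalOfEmb_eq_conjMap W κ v hγ hg n c).symm

end Generic

section TatePairing

variable (W : WeierstrassCurve ℚ) [W.IsElliptic] {p : ℕ} [Fact p.Prime] [ContinuousSMul ℤ_[p] (W.tateModule p)]
  (κ : ZpExtension ℚ p) {γ : absoluteGaloisGroup ℚ} (v : HeightOneSpectrum (𝓞 ℚ))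
  {g : absoluteGaloisGroup (v.adicCompletion ℚ)}

/-- ★ **`pairFun` for THE `T_pW`-adic local Tate pairings of the layers** (cyclotomic `κ`, `v ∣ p`): there are the `ℤ_p`-adic layer
pairings `pair n` with residues `CyclotomicLayer.tatePairingPk W κ v n k` (which PIN them), (P1) and (P2)
(`SignedKatoOffTwo.LayerPairing.exists_linear_tatePairing`), and a `Λ`-linear `L : I.H →ₗ[Λ] (E(ℚ_∞·ℚ_v) →+ ℤ_p)` with
`L x Q = ⟨proj_n x, Q⟩_n` — hence `toZModPow k (L x Q) = tatePairingPk n k (proj_n x) Q` for all `k`.  This `L` is the `loc_v` of the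
♭ package's displayed-witness contract (`loc := Col♭ ∘ₗ L`, `P := ⊤`). [cite: Kato2004Asterisque, §12.2 (p. 220), §13.8 (pp. 228–229), §17.13 (p. 279)]
[cite: Kobayashi2003, (8.23) (p. 18)] [cite: PerrinRiou1994Invent, §3.6.1] -/
theorem exists_linearMap_pairFun_tatePairing (hκ : κ.IsCyclotomic) (hv : (p : 𝓞 ℚ) ∈ v.asIdeal) (hγ : κ.IsTopGenerator γ)
    (hg : κ.IsTopGenerator (resGalOfEmb (closureEmb (K := ℚ) (v.adicCompletion ℚ)) g)) (I : IwasawaH1Data W p κ γ) :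
    letI := moduleOfGenerator κ (closureEmb (K := ℚ) (v.adicCompletion ℚ)) W hg
    ∃ (pair : ∀ n : ℕ, H1 (tateRep W p) (κ.layerSubgroup n) →ₗ[ℤ_[p]]
        (localLayerPointsOfEmb κ (closureEmb (K := ℚ) (v.adicCompletion ℚ)) W n →+ ℤ_[p]))
      (L : I.H →ₗ[IwasawaAlgebra p] (localTowerPointsOfEmb κ (closureEmb (K := ℚ) (v.adicCompletion ℚ)) W →+ ℤ_[p])),
      (∀ (n k : ℕ) (x : H1 (tateRep W p) (κ.layerSubgroup n))
          (Q : localLayerPointsOfEmb κ (closureEmb (K := ℚ) (v.adicCompletion ℚ)) W n),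
          PadicInt.toZModPow k (pair n x Q) = CyclotomicLayer.tatePairingPk W κ v n k x Q) ∧
      (∀ (n : ℕ) (x : H1 (tateRep W p) (κ.layerSubgroup (n + 1))) (Q : localPoints W (v.adicCompletion ℚ))
          (hQ : Q ∈ localLayerPointsOfEmb κ (closureEmb (K := ℚ) (v.adicCompletion ℚ)) W n),
          pair n (layerCores (tateRep W p) κ n x) ⟨Q, hQ⟩ =
            pair (n + 1) x ⟨Q, localLayerPointsOfEmb_mono κ (closureEmb (K := ℚ) (v.adicCompletion ℚ)) W
              (Nat.le_succ n) hQ⟩) ∧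
      (∀ (n : ℕ) (g : absoluteGaloisGroup (v.adicCompletion ℚ)) (y : H1 (tateRep W p) (κ.layerSubgroup n))
          (Q : localPoints W (v.adicCompletion ℚ))
          (hQ : Q ∈ localLayerPointsOfEmb κ (closureEmb (K := ℚ) (v.adicCompletion ℚ)) W n),
          pair n (conjMap (tateRep W p).toTopRep (κ.layerSubgroup n)
              (resGalOfEmb (closureEmb (K := ℚ) (v.adicCompletion ℚ)) g) 1 y)
            ⟨g • Q, smul_mem_localLayerPointsOfEmb κ (closureEmb (K := ℚ) (v.adicCompletion ℚ)) W n g hQ⟩ =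
          pair n y ⟨Q, hQ⟩) ∧
      (∀ (x : I.H) (n : ℕ) (Q : localPoints W (v.adicCompletion ℚ))
          (hQ : Q ∈ localLayerPointsOfEmb κ (closureEmb (K := ℚ) (v.adicCompletion ℚ)) W n),
          L x ⟨Q, localLayerPointsOfEmb_le_localTowerPointsOfEmb κ _ W n hQ⟩ = pair n (I.proj n x) ⟨Q, hQ⟩) ∧
      (∀ (x : I.H) (n k : ℕ) (Q : localPoints W (v.adicCompletion ℚ))
          (hQ : Q ∈ localLayerPointsOfEmb κ (closureEmb (K := ℚ) (v.adicCompletion ℚ)) W n),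
          PadicInt.toZModPow k (L x ⟨Q, localLayerPointsOfEmb_le_localTowerPointsOfEmb κ _ W n hQ⟩) =
            CyclotomicLayer.tatePairingPk W κ v n k (I.proj n x) ⟨Q, hQ⟩) := by
  obtain ⟨pair, hres, hP1, hP2⟩ := SignedKatoOffTwo.LayerPairing.exists_linear_tatePairing W κ v hκ hv
  obtain ⟨L, hL⟩ := exists_linearMap_pairFun W κ v pair hγ hg hP1 hP2 I
  exact ⟨pair, L, hres, hP1, hP2, hL, fun x n k Q hQ ↦ by rw [hL x n Q hQ, hres]⟩

end TatePairing

end SSFlatPackage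

end Summit.BirchSwinnertonDyer.BirchSwinnertonDyer.Theorems

end
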